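import Mathlib
import Literature.Analysis.PDE.Wave1DChannelScaling
import Summits.FinalStateConjecture.FinalStateConjecture.Theorems.PhotonSphereChannelsFarPotentialAsymptotics
import Summits.FinalStateConjecture.FinalStateConjecture.Theorems.PhotonSphereChannelsFixedModeReduction
import Summits.FinalStateConjecture.FinalStateConjecture.Theorems.PhotonSphereChannelsNearChannels

/-!
# Route PhotonSphereChannels — `FixedModeChannels` reduces to ONE unit-scale far channel estimate

Item stmt-FinalStateConjecture-10048 (`FixedModeChannels`). The reduction
`Theorems.fixedModeChannels_of_near_far` and the near half `Theorems.nearHalfLineChannels` are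
landed; this file reduces the remaining FAR half-line channel estimate (second hypothesis of the
reduction, verbatim) to a single statement about potentials CLOSE TO `n(n+1)/y²` ON THE UNIT FAR
CONE, with no reference to Schwarzschild, tortoise functions, `M`, `s` or `ρ`:

  `UnitFarChannel n`:  there are `ε > 0` and `c > 0` such that for every continuous `W ≥ 0` on `ℝ`
  with `|W(y) − n(n+1)/y²| ≤ ε y^{−5/2}` for `y ≥ ½`, and every global `C²` solution `φ` of
  `φ_tt − φ_yy + Wφ = 0`, the one-ended exterior channel inequality holds on `{y > 1 + |t|}` with
  constant `c` and kernel = `t`-polynomial `C²` solutions on that cone (verbatim vocabulary).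

`farHalfLineChannels_of_unitFarChannel : (∀ n, UnitFarChannel n) → FarHalfLineChannels` rescales:
for `ρ ≥ ρ₀(M, ℓ, ε(ℓ))` the potential `W(y) = ρ² V_{s,ℓ}(xc + ρy)` is `ε y^{−5/2}`-close to
`ℓ(ℓ+1)/y²` uniformly over all tortoise functions (`Theorems.rwPotential_rescaled_close`), the
rescaled wave `φ(τ,y) = ψ(ρτ, xc + ρy)` is a global `C²` solution for `W`, and the unit-scale
inequality transports back to the edge `xc + ρ` with the same constant
(`Literature.Analysis.PDE.farChannelInequality_of_unitScale`). Hence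
`fixedModeChannels_of_unitFarChannel : (∀ n, UnitFarChannel n) → <FixedModeChannels, verbatim body>`.
The unit statement is written inline (no definition) as the hypothesis `hcore`; proving it for every
`n` closes the item. It is the natural meeting point of the landed far-side bricks: exact
inverse-square channel estimate (`inverseSquare_channel_estimate`), Duhamel comparison, true
non-radiating kernel (`TruePolynomialKernel`, recessive/dominant chains), kernel absorption
(`Literature.Analysis.Approximation.kernel_absorption`) and the basis constant
(`exists_sum_abs_le_sqrt_integral`).
-/

noncomputable section

namespace Summit.FinalStateConjecture.FinalStateConjecture.Theorems

open Set Filter MeasureTheory Literature.Analysis.PDE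
open scoped _root_.Topology _root_.ENNReal

/-- **Far half-line channels from the unit-scale far channel estimate.** See the module docstring;
the conclusion is hypothesis `hfar` of `fixedModeChannels_of_near_far`, verbatim. -/
theorem farHalfLineChannels_of_unitFarChannel
    (hcore : ∀ n : ℕ, ∃ ε : ℝ, 0 < ε ∧ ∃ c : ℝ, 0 < c ∧ ∀ W : ℝ → ℝ, Continuous W →
      (∀ y, 0 ≤ W y) →
      (∀ y : ℝ, 1 / 2 ≤ y → |W y - (n : ℝ) * ((n : ℝ) + 1) / y ^ 2| ≤ ε * y ^ (-(5 : ℝ) / 2)) →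
      ∀ φ : ℝ → ℝ → ℝ, ContDiff ℝ 2 (Function.uncurry φ) →
      (∀ t y, iteratedDeriv 2 (fun τ => φ τ y) t - iteratedDeriv 2 (φ t) y + W y * φ t y = 0) →
      let e₁ : (ℝ → ℝ → ℝ) → ℝ → ℝ → ℝ := fun φ t x =>
        deriv (fun τ => φ τ x) t ^ 2 + deriv (φ t) x ^ 2 + W x * φ t x ^ 2
      let IsSol₁ : (ℝ → ℝ → ℝ) → ℝ × ℝ → Prop := fun φ z =>
        iteratedDeriv 2 (fun τ => φ τ z.2) z.1 - iteratedDeriv 2 (φ z.1) z.2 + W z.2 * φ z.1 z.2 = 0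
      let Ω₁ : Set (ℝ × ℝ) := {z | 1 + |z.1| < z.2}
      let P₁ : Set (ℝ → ℝ → ℝ) := {p | ContDiffOn ℝ 2 (Function.uncurry p) Ω₁ ∧
        (∀ z ∈ Ω₁, IsSol₁ p z) ∧ ∃ (N : ℕ) (a : ℕ → ℝ → ℝ), ∀ z ∈ Ω₁,
          p z.1 z.2 = ∑ i ∈ Finset.range N, a i z.2 * z.1 ^ i}
      let E₁ : ℝ → ℝ≥0∞ := fun t => ∫⁻ x in Ioi (1 + |t|), ENNReal.ofReal (e₁ φ t x)
      ENNReal.ofReal c * (⨅ p ∈ P₁, ∫⁻ x in Ioi 1,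
          ENNReal.ofReal (e₁ (fun t y => φ t y - p t y) 0 x))
        ≤ liminf E₁ atTop + liminf E₁ atBot) :
    ∀ M : ℝ, 0 < M → ∀ (s ℓ : ℕ), s ≤ 2 → s ≤ ℓ → ∃ ρ₀ : ℝ, 0 ≤ ρ₀ ∧ ∃ c : ℝ, 0 < c ∧ ∀ (r : ℝ → ℝ) (xc : ℝ), (∀ x, 2 * M < r x) → (∀ x, HasDerivAt r (1 - 2 * M / r x) x) → r xc = 3 * M → ∀ ρ : ℝ, ρ₀ ≤ ρ → ∀ ψ : ℝ → ℝ → ℝ, ContDiff ℝ 2 (Function.uncurry ψ) → let V : ℝ → ℝ := fun x => (1 - 2 * M / r x) * ((ℓ : ℝ) * ((ℓ : ℝ) + 1) / r x ^ 2 + (1 - (s : ℝ) ^ 2) * (2 * M) / r x ^ 3); let e : (ℝ → ℝ → ℝ) → ℝ → ℝ → ℝ := fun φ t x => deriv (fun τ => φ τ x) t ^ 2 + deriv (φ t) x ^ 2 + V x * φ t x ^ 2; let IsSol : (ℝ → ℝ → ℝ) → ℝ × ℝ → Prop := fun φ z => iteratedDeriv 2 (fun τ => φ τ z.2) z.1 -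 iteratedDeriv 2 (φ z.1) z.2 + V z.2 * φ z.1 z.2 = 0; let Ω : Set (ℝ × ℝ) := {z | xc + ρ + |z.1| < z.2}; let P : Set (ℝ → ℝ → ℝ) := {p | ContDiffOn ℝ 2 (Function.uncurry p) Ω ∧ (∀ z ∈ Ω, IsSol p z) ∧ ∃ (N : ℕ) (a : ℕ → ℝ → ℝ), ∀ z ∈ Ω, p z.1 z.2 = ∑ i ∈ Finset.range N, a i z.2 * z.1 ^ i}; let Eext : ℝ → ENNReal := fun t => MeasureTheory.lintegral (MeasureTheory.volume.restrict (Set.Ioi (xc + ρ + |t|))) (fun x => ENNReal.ofReal (e ψ t x)); (∀ z, IsSol ψ z) → ENNReal.ofReal c * (⨅ p ∈ P, MeasureTheory.lintegral (MeasureTheory.volume.restrict (Set.Ioi (xc + ρ))) (fun x => ENNReal.ofReal (e (fun t y => ψ t y - p t y) 0 x))) ≤ Filter.liminf Eext Filter.atTop + Filter.liminf Eext Filter.atBot := by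
  intro M hM s ℓ hs hsℓ
  obtain ⟨ε, hε, c, hc, hunit⟩ := hcore ℓ
  obtain ⟨ρ₀, hρ₀, hT⟩ := rwPotential_rescaled_close hM s ℓ hs hε
  refine ⟨ρ₀, hρ₀.le, c, hc, ?_⟩
  intro r xc hr hr' hxc ρ hρ ψ hψ V e IsSol Ω P Eext hsol
  have hρpos : 0 < ρ := lt_of_lt_of_le hρ₀ hρ
  -- the potential: continuity and sign
  have hrc : Continuous r := continuous_iff_continuousAt.2 fun x => (hr' x).continuousAt
  have hr0 : ∀ x, r x ≠ 0 := fun x => (lt_trans (by positivity) (hr x)).ne'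
  have hVc : Continuous V := by
    show Continuous fun x => (1 - 2 * M / r x) * ((ℓ : ℝ) * ((ℓ : ℝ) + 1) / r x ^ 2
      + (1 - (s : ℝ) ^ 2) * (2 * M) / r x ^ 3)
    exact (continuous_const.sub (continuous_const.div hrc hr0)).mul
      ((continuous_const.div (hrc.pow 2) fun x => pow_ne_zero 2 (hr0 x)).add
        (continuous_const.div (hrc.pow 3) fun x => pow_ne_zero 3 (hr0 x)))
  have hV0 : ∀ x, 0 ≤ V x := fun x => rwPotential_nonneg hM (hr x) hs hsℓ
  -- the rescaled potential and wave
  set W : ℝ → ℝ := fun y => ρ ^ 2 * V (xc + ρ * y) with hW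
  set φ : ℝ → ℝ → ℝ := fun τ y => ψ (ρ * τ) (xc + ρ * y) with hφ
  have hWc : Continuous W :=
    continuous_const.mul (hVc.comp (continuous_const.add (continuous_const.mul continuous_id)))
  have hW0 : ∀ y, 0 ≤ W y := fun y => mul_nonneg (sq_nonneg ρ) (hV0 _)
  have hWclose : ∀ y : ℝ, 1 / 2 ≤ y →
      |W y - (ℓ : ℝ) * ((ℓ : ℝ) + 1) / y ^ 2| ≤ ε * y ^ (-(5 : ℝ) / 2) :=
    fun y hy => hT r xc hr hr' hxc ρ hρ y hy
  have hφC : ContDiff ℝ 2 (Function.uncurry φ) := by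
    have : Function.uncurry φ = Function.uncurry ψ ∘ fun p : ℝ × ℝ => (ρ * p.1, xc + ρ * p.2) := by
      funext p; rfl
    rw [this]
    exact hψ.comp ((contDiff_const.mul contDiff_fst).prodMk
      (contDiff_const.add (contDiff_const.mul contDiff_snd)))
  have hφsol : ∀ t y, iteratedDeriv 2 (fun τ => φ τ y) t - iteratedDeriv 2 (φ t) y
      + W y * φ t y = 0 := by
    intro t y
    have h1 : iteratedDeriv 2 (fun τ => φ τ y) t
        = ρ ^ 2 * iteratedDeriv 2 (fun σ => ψ σ (xc + ρ * y)) (ρ * t) := by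
      have := iteratedDeriv_two_comp_affine (fun σ => ψ σ (xc + ρ * y)) ρ 0 t
      simp only [add_zero] at this
      exact this
    have h2 : iteratedDeriv 2 (φ t) y = ρ ^ 2 * iteratedDeriv 2 (ψ (ρ * t)) (xc + ρ * y) := by
      have e2 : φ t = fun y' => ψ (ρ * t) (ρ * y' + xc) := by
        funext y'; simp only [hφ, add_comm xc]
      rw [e2, iteratedDeriv_two_comp_affine (ψ (ρ * t)) ρ xc y, add_comm (ρ * y) xc]
    have h0 : iteratedDeriv 2 (fun τ => ψ τ (xc + ρ * y)) (ρ * t)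
        - iteratedDeriv 2 (ψ (ρ * t)) (xc + ρ * y) + V (xc + ρ * y) * ψ (ρ * t) (xc + ρ * y) = 0 :=
      hsol (ρ * t, xc + ρ * y)
    have hWy : W y * φ t y = ρ ^ 2 * (V (xc + ρ * y) * ψ (ρ * t) (xc + ρ * y)) := by
      simp only [hW, hφ]; ring
    rw [h1, h2, hWy]
    have : ρ ^ 2 * iteratedDeriv 2 (fun σ => ψ σ (xc + ρ * y)) (ρ * t)
        - ρ ^ 2 * iteratedDeriv 2 (ψ (ρ * t)) (xc + ρ * y)
        + ρ ^ 2 * (V (xc + ρ * y) * ψ (ρ * t) (xc + ρ * y))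
        = ρ ^ 2 * (iteratedDeriv 2 (fun τ => ψ τ (xc + ρ * y)) (ρ * t)
          - iteratedDeriv 2 (ψ (ρ * t)) (xc + ρ * y)
          + V (xc + ρ * y) * ψ (ρ * t) (xc + ρ * y)) := by ring
    rw [this, h0, mul_zero]
  -- the unit-scale inequality for `(W, φ)` and its transport back
  have key := hunit W hWc hW0 hWclose φ hφC hφsol
  exact farChannelInequality_of_unitScale (V := V) (ψ := ψ) (xc := xc) (c := c) hρpos key

/-- **`FixedModeChannels` from the unit-scale far channel estimate.** The conclusion is VERBATIM
the body of the route decl `…Theses.PhotonSphereChannels.FixedModeChannels` (this module does not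
import the route file, so that the closing module stays importable by it): near half =
`nearHalfLineChannels`, far half = `farHalfLineChannels_of_unitFarChannel`, glue =
`fixedModeChannels_of_near_far`. -/
theorem fixedModeChannels_of_unitFarChannel
    (hcore : ∀ n : ℕ, ∃ ε : ℝ, 0 < ε ∧ ∃ c : ℝ, 0 < c ∧ ∀ W : ℝ → ℝ, Continuous W →
      (∀ y, 0 ≤ W y) →
      (∀ y : ℝ, 1 / 2 ≤ y → |W y - (n : ℝ) * ((n : ℝ) + 1) / y ^ 2| ≤ ε * y ^ (-(5 : ℝ) / 2)) →
      ∀ φ : ℝ → ℝ → ℝ, ContDiff ℝ 2 (Function.uncurry φ) →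
      (∀ t y, iteratedDeriv 2 (fun τ => φ τ y) t - iteratedDeriv 2 (φ t) y + W y * φ t y = 0) →
      let e₁ : (ℝ → ℝ → ℝ) → ℝ → ℝ → ℝ := fun φ t x =>
        deriv (fun τ => φ τ x) t ^ 2 + deriv (φ t) x ^ 2 + W x * φ t x ^ 2
      let IsSol₁ : (ℝ → ℝ → ℝ) → ℝ × ℝ → Prop := fun φ z =>
        iteratedDeriv 2 (fun τ => φ τ z.2) z.1 - iteratedDeriv 2 (φ z.1) z.2 + W z.2 * φ z.1 z.2 = 0
      let Ω₁ : Set (ℝ × ℝ) := {z | 1 + |z.1| < z.2}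
      let P₁ : Set (ℝ → ℝ → ℝ) := {p | ContDiffOn ℝ 2 (Function.uncurry p) Ω₁ ∧
        (∀ z ∈ Ω₁, IsSol₁ p z) ∧ ∃ (N : ℕ) (a : ℕ → ℝ → ℝ), ∀ z ∈ Ω₁,
          p z.1 z.2 = ∑ i ∈ Finset.range N, a i z.2 * z.1 ^ i}
      let E₁ : ℝ → ℝ≥0∞ := fun t => ∫⁻ x in Ioi (1 + |t|), ENNReal.ofReal (e₁ φ t x)
      ENNReal.ofReal c * (⨅ p ∈ P₁, ∫⁻ x in Ioi 1,
          ENNReal.ofReal (e₁ (fun t y => φ t y - p t y) 0 x))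
        ≤ liminf E₁ atTop + liminf E₁ atBot) :
    ∀ M : ℝ, 0 < M → ∀ (s ℓ : ℕ), s ≤ 2 → s ≤ ℓ → ∃ ρ₀ : ℝ, 0 ≤ ρ₀ ∧ ∃ c : ℝ, 0 < c ∧ ∀ (r : ℝ → ℝ) (xc : ℝ), (∀ x, 2 * M < r x) → (∀ x, HasDerivAt r (1 - 2 * M / r x) x) → r xc = 3 * M → ∀ ρ : ℝ, ρ₀ ≤ ρ → ∀ ψ : ℝ → ℝ → ℝ, ContDiff ℝ 2 (Function.uncurry ψ) → let V : ℝ → ℝ := fun x => (1 - 2 * M / r x) * ((ℓ : ℝ) * ((ℓ : ℝ) + 1) / r x ^ 2 + (1 - (s : ℝ) ^ 2) * (2 * M) / r x ^ 3); let e : (ℝ → ℝ → ℝ) → ℝ → ℝ → ℝ := fun φ t x => deriv (fun τ => φ τ x) t ^ 2 + deriv (φ t) x ^ 2 + V x * φ t x ^ 2; let IsSol : (ℝ → ℝ → ℝ) → ℝ × ℝ → Prop := fun φ z => iteratedDeriv 2 (fun τ => φ τ z.2) z.1 - iteratedDeriv 2 (φ z.1) z.2 + V z.2 * φ z.1 z.2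 = 0; let Ω : Set (ℝ × ℝ) := {z | ρ + |z.1| < |z.2 - xc|}; let P : Set (ℝ → ℝ → ℝ) := {p | ContDiffOn ℝ 2 (Function.uncurry p) Ω ∧ (∀ z ∈ Ω, IsSol p z) ∧ ∃ (N : ℕ) (a : ℕ → ℝ → ℝ), ∀ z ∈ Ω, p z.1 z.2 = ∑ i ∈ Finset.range N, a i z.2 * z.1 ^ i}; let Eext : ℝ → ENNReal := fun t => MeasureTheory.lintegral (MeasureTheory.volume.restrict {x : ℝ | ρ + |t| < |x - xc|}) (fun x => ENNReal.ofReal (e ψ t x)); (∀ z, IsSol ψ z) → ENNReal.ofReal c * (⨅ p ∈ P, MeasureTheory.lintegral (MeasureTheory.volume.restrict {x : ℝ | ρ < |x - xc|}) (fun x => ENNReal.ofReal (e (fun t y => ψ t y - p t y) 0 x))) ≤ Filter.liminf Eext Filter.atTop + Filter.liminf Eext Filter.atBot :=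
  fixedModeChannels_of_near_far nearHalfLineChannels (farHalfLineChannels_of_unitFarChannel hcore)

end Summit.FinalStateConjecture.FinalStateConjecture.Theorems
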